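import Literature.Geometry.Kaehler.HolomorphicChartForms
import Literature.Geometry.Kaehler.LefschetzPointwise
import Literature.Geometry.Kaehler.ManifoldFormsFunSmulProofs
import Literature.Geometry.Kaehler.ConnectionExists
import Mathlib.Geometry.Manifold.PartitionOfUnity
import HarnessLib

/-!
# Gluing chart-holomorphic forms by a partition of unity: smoothness, vertical agreement and the
# vertical `(1,0)`-condition of the differential (Griffiths 1968 §II; Voisin I §9.1–§9.2, §10.2.2)

Layer `Literature/Geometry/Kaehler`; proof file (theorems only, no definition, no named fact). Written
by the prover seat `hodge-nonav-prover-Bx` (g14, cell `hodge-nonav`) for prover-Ax's programme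
«GRIFFITHS-SURFACES» / «B4 RELATIVE RESIDUES» (route `HodgeConjecture/CyclicUnitaryPowers`,
`--supports stmt-HodgeConjecture-19544`), letter **F-A**: pure algebra of forms on ONE real manifold `T`
charted on a complex normed space `ET` (no algebraic geometry).

DATA (all statements): a finite index type `ι`, opens `U a ⊆ T`, complex `k`-forms `Ξ a` which are
HOLOMORPHIC IN CHARTS at the points of `U a` — at `y ∈ U a` the chart representative `(Ξ a).inChart y`
agrees near the centre with `z ↦ (g z)|_ℝ` for a complex-analytic germ `g` valued in `ℂ`-alternating
maps (the pointwise form of `IsHolomorphicInCharts`; exactly what the relative residue forms of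
`RelativeResidueForms` deliver) —, smooth real functions `χ a` with `tsupport (χ a) ⊆ U a`, an arbitrary
"verticality" predicate `Vert : T → ET → Prop` on tangent vectors, an open `G'` on which `Σ_a χ a = 1`,
and the AGREEMENT of the `Ξ a` on vertical tuples at the points of `G'`. The glued form is written
`∑ a, χ a • Ξ a` in every statement.

* `MForm.smoothAt_of_analyticGerm`, `MForm.exists_apply_eq_restrictScalars_of_analyticGerm`,
  `MForm.exists_mextDeriv_eq_restrictScalars_of_analyticGerm` — the three pointwise consequences of a
  complex-analytic chart germ at `y`: `η` is smooth at `y`, and `η y`, `dη y` are restrictions of scalars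
  of `ℂ`-alternating maps (`d = ∂` on holomorphic forms, Voisin I §2.3.3; the computations of
  `IsHolomorphicInCharts.isSmoothForm` / `exists_apply_eq_restrictScalars` /
  `exists_extDeriv_inChart_eq_restrictScalars`, localised to one point);
* `wedgeOne_restrictScalars_vecCons_I_smul_sub` — the one line of multilinear algebra:
  `(θ ∧ A|_ℝ)(iu, w) - i (θ ∧ A|_ℝ)(u, w) = (θ(iu) - i θ(u)) · A(w)` for a real covector `θ` and a
  `ℂ`-alternating `A` (only the slot-`0` term of `θ ∧ ·` is not `ℂ`-linear);
* `MForm.smoothAt_fun_smul_of_tsupport_subset`, `isSmoothForm_sum_smul` — **(1) the glued form is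
  smooth** (`χ a • Ξ a` is smooth at the points of `U a` by the Leibniz bookkeeping and vanishes near
  every other point);
* `sum_smul_apply_eq_of_vertical` — **(2) on vertical tuples at `y ∈ G' ∩ U a` the glued form equals
  `Ξ a`** (`Σ χ = 1` and agreement);
* `mextDeriv_sum_smul_cons_I_smul` — **(3) the vertical `(1,0)`-condition**: at `y ∈ G'`, for
  vertical `w`, `d(∑ χ a • Ξ a) y (i v, w) = i · d(∑ χ a • Ξ a) y (v, w)`. Proof: Leibniz
  `d(χ • Ξ) = χ dΞ + dχ ∧ Ξ` at each `a` (`mextDeriv_fun_smul_apply`; trivially `0 = 0` off `U a`);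
  `χ a y · dΞ_a y` and the slots `≥ 1` of `dχ_a ∧ Ξ_a y` are `ℂ`-linear in `v` (the values are
  restrictions of `ℂ`-alternating maps); the slot-`0` terms are `dχ_a(v) · Ξ_a y (w)`, and by agreement
  `Ξ_a y (w) = c_w` is independent of `a`, so they sum to `d(Σ_a χ_a)(v) · c_w = 0` since `Σ χ = 1`
  near `y`. This is the hypothesis `hdΞ` of
  `PeriodIntegralHolomorphicVertical.differentiableAt_complex_cintegral_wedge_pullback_family_of_vertical`
  with `Vert y w := (dπ_y w = 0)`;
* `exists_smooth_partition_subordinate` — **(4)** a smooth partition of unity subordinate to a finite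
  open cover of a closed set, from Mathlib's `SmoothPartitionOfUnity.exists_isSubordinate`.

Tuples in the algebraic lemma are written with `Matrix.vecCons` (definitionally `Fin.cons`, the
spelling of Mathlib's `ContinuousAlternatingMap.curryLeft_apply_apply` / `vecCons_smul`); theorem (3)
is stated with `Fin.cons` as in `PeriodIntegralHolomorphicVertical`. Honest scope: bookkeeping of forms;
nothing here says HC or any rung is proved.

## References

* [Griffiths1968PeriodsII] P. Griffiths, Periods of integrals on algebraic manifolds II, Amer. J.
  Math. 90 (1968), §II (relative holomorphic forms and their periods).
* [VoisinHodgeI2002] C. Voisin, Hodge Theory and Complex Algebraic Geometry I, CUP 2002, §2.3.3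
  (`d = ∂` on holomorphic forms), §9.1.1–§9.2.2, §10.2.2 (proof of Thm. 10.9).
* [WarnerGTM94] F. Warner, Foundations of Differentiable Manifolds and Lie Groups, GTM 94 (1983),
  Thm. 2.20 (Leibniz rule), 1.11 (partitions of unity).
* [LeeSmoothManifolds2013] J. M. Lee, Introduction to Smooth Manifolds, 2nd ed. (2013), Thm. 2.23.
-/

noncomputable section

open scoped Manifold ContDiff Topology
open Set Filter Complex ContinuousAlternatingMap
open Literature.LinearAlgebra.Alternating
open Literature.NumberTheory.Transcendental

namespace Literature.Geometry.Kaehler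

-- The identification `TangentSpace I x = E` is an abuse of definitional equality; as in the tree's
-- form files we let `isDefEq` unfold it.
set_option backward.isDefEq.respectTransparency false

/-! ### Multilinear algebra: the slot-`0` defect of `θ ∧ A|_ℝ` -/

section Algebra

variable {E : Type*} [NormedAddCommGroup E] [NormedSpace ℂ E] {k : ℕ}

/-- `θ ∧ (c • ζ) = c • (θ ∧ ζ)` for a REAL covector `θ`, complex scalars `c` and a real-alternating
`ℂ`-valued `ζ` (the real scalars `θ(vᵢ)` commute with `c`; bilinearity of `∧`, Warner 2.6).
[cite: WarnerGTM94, 2.6] -/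
theorem wedgeOne_complex_smul (θ : E →L[ℝ] ℝ) (c : ℂ) (ζ : E [⋀^Fin k]→L[ℝ] ℂ) :
    wedgeOne θ (c • ζ) = c • wedgeOne θ ζ := by
  ext v
  simp only [wedgeOne_apply, ContinuousAlternatingMap.smul_apply, smul_eq_mul, Complex.real_smul,
    zsmul_eq_mul, Finset.mul_sum]
  exact Finset.sum_congr rfl fun i _ ↦ by ring

/-- **The slot-`0` defect of `θ ∧ A|_ℝ`.** For a real covector `θ : E →L[ℝ] ℝ` on a complex space, a
`ℂ`-alternating `k`-form `A` and `u : E`, `w : Fin k → E`: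
`(θ ∧ A|_ℝ)(i u, w) - i · (θ ∧ A|_ℝ)(u, w) = (θ(i u) - i θ(u)) · A(w)` — every term of the
alternating sum in which `u` enters `A` is `ℂ`-linear in `u`, only the term `θ(u) · A(w)` is not.
(`u ⌟ (θ ∧ η) = θ(u) η - θ ∧ (u ⌟ η)`, Warner 2.11, and `A(i u, ·) = i A(u, ·)`.) [cite: WarnerGTM94, 2.11] -/
theorem wedgeOne_restrictScalars_vecCons_I_smul_sub (θ : E →L[ℝ] ℝ) (A : E [⋀^Fin k]→L[ℂ] ℂ)
    (u : E) (w : Fin k → E) :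
    wedgeOne θ (A.restrictScalars ℝ) (Matrix.vecCons (I • u) w) -
        I * wedgeOne θ (A.restrictScalars ℝ) (Matrix.vecCons u w) =
      ((θ (I • u) : ℂ) - I * θ u) * A w := by
  obtain _ | m := k
  · -- degree `0`: `(θ ∧ η)(u) = θ(u) η`
    have h0 : ∀ u' : E, wedgeOne θ (A.restrictScalars ℝ) (Matrix.vecCons u' w) = (θ u' : ℂ) * A w := by
      intro u'
      rw [← curryLeft_apply_apply, curryLeft_wedgeOne_zero, ContinuousAlternatingMap.smul_apply,
        ContinuousAlternatingMap.coe_restrictScalars, Complex.real_smul]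
    rw [h0, h0]
    ring
  · -- degree `m + 1`: `u ⌟ (θ ∧ η) = θ(u) η - θ ∧ (u ⌟ η)` and `(i u) ⌟ A|_ℝ = i · (u ⌟ A|_ℝ)`
    have hcurry : (A.restrictScalars ℝ).curryLeft (I • u) = I • (A.restrictScalars ℝ).curryLeft u := by
      ext v
      simp only [curryLeft_apply_apply, ContinuousAlternatingMap.coe_restrictScalars,
        ContinuousAlternatingMap.smul_apply, ContinuousAlternatingMap.vecCons_smul, smul_eq_mul]
    have h1 : ∀ u' : E, wedgeOne θ (A.restrictScalars ℝ) (Matrix.vecCons u' w) =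
        (θ u' : ℂ) * A w - wedgeOne θ ((A.restrictScalars ℝ).curryLeft u') w := by
      intro u'
      rw [← curryLeft_apply_apply (wedgeOne θ (A.restrictScalars ℝ)), curryLeft_wedgeOne,
        ContinuousAlternatingMap.sub_apply, ContinuousAlternatingMap.smul_apply,
        ContinuousAlternatingMap.coe_restrictScalars, Complex.real_smul]
    rw [h1, h1, hcurry, wedgeOne_complex_smul, ContinuousAlternatingMap.smul_apply, smul_eq_mul]
    ring

end Algebra

/-! ### Pointwise consequences of a complex-analytic chart germ -/

section Germ

variable {E : Type*} [NormedAddCommGroup E] [NormedSpace ℂ E]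
  {M : Type*} [TopologicalSpace M] [ChartedSpace E M] {k : ℕ}

/-- **A form with a complex-analytic chart germ at `x` is smooth at `x`** (a complex-analytic germ is
real `C^∞`; the pointwise form of `IsHolomorphicInCharts.isSmoothForm`). [cite: VoisinHodgeI2002, §2.3.1] -/
theorem MForm.smoothAt_of_analyticGerm {η : MForm 𝓘(ℝ, E) M ℂ k} {x : M}
    (h : ∃ g : E → E [⋀^Fin k]→L[ℂ] ℂ, AnalyticAt ℂ g (extChartAt 𝓘(ℝ, E) x x) ∧
      η.inChart x =ᶠ[𝓝 (extChartAt 𝓘(ℝ, E) x x)] fun z ↦ (g z).restrictScalars ℝ) :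
    η.SmoothAt x := by
  obtain ⟨g, hg, heq⟩ := h
  have h1 : ContDiffAt ℝ ∞ (fun y ↦ (g y).restrictScalars ℝ) (extChartAt 𝓘(ℝ, E) x x) := by
    have h3 : ContDiffAt ℝ ∞ g (extChartAt 𝓘(ℝ, E) x x) := (hg.contDiffAt (n := ∞)).restrict_scalars ℝ
    exact (ContinuousAlternatingMap.restrictScalarsCLM (𝕜 := ℂ) (E := E) (F := ℂ) (ι := Fin k)
      ℝ).contDiff.contDiffAt.comp _ h3
  exact (h1.congr_of_eventuallyEq heq).contDiffWithinAt

/-- **A form with a complex-analytic chart germ at `x` is `ℂ`-alternating at `x`**: `η x = A|_ℝ`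
for the value `A` of the germ at the centre (pointwise form of
`IsHolomorphicInCharts.exists_apply_eq_restrictScalars`). [cite: VoisinHodgeI2002, §2.3.1] -/
theorem MForm.exists_apply_eq_restrictScalars_of_analyticGerm [IsManifold 𝓘(ℝ, E) ∞ M]
    {η : MForm 𝓘(ℝ, E) M ℂ k} {x : M}
    (h : ∃ g : E → E [⋀^Fin k]→L[ℂ] ℂ, AnalyticAt ℂ g (extChartAt 𝓘(ℝ, E) x x) ∧
      η.inChart x =ᶠ[𝓝 (extChartAt 𝓘(ℝ, E) x x)] fun z ↦ (g z).restrictScalars ℝ) :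
    ∃ A : E [⋀^Fin k]→L[ℂ] ℂ, η x = A.restrictScalars ℝ := by
  obtain ⟨g, -, heq⟩ := h
  refine ⟨g (extChartAt 𝓘(ℝ, E) x x), ?_⟩
  rw [← MForm.inChart_apply_self η x]
  exact heq.eq_of_nhds

/-- **`dη x` is `ℂ`-alternating for a form with a complex-analytic chart germ at `x`** (`d = ∂` on
holomorphic forms: the real derivative of `z ↦ (g z)|_ℝ` is the restriction of the `ℂ`-derivative, and
`dη x` is Mathlib's `extDeriv` of the representative at the centre, `mextDeriv_eq_extDerivWithin`;
pointwise form of `IsHolomorphicInCharts.exists_extDeriv_inChart_eq_restrictScalars`).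
[cite: VoisinHodgeI2002, §2.3.3] -/
theorem MForm.exists_mextDeriv_eq_restrictScalars_of_analyticGerm [IsManifold 𝓘(ℝ, E) ∞ M]
    {η : MForm 𝓘(ℝ, E) M ℂ k} {x : M}
    (h : ∃ g : E → E [⋀^Fin k]→L[ℂ] ℂ, AnalyticAt ℂ g (extChartAt 𝓘(ℝ, E) x x) ∧
      η.inChart x =ᶠ[𝓝 (extChartAt 𝓘(ℝ, E) x x)] fun z ↦ (g z).restrictScalars ℝ) :
    ∃ A' : E [⋀^Fin (k + 1)]→L[ℂ] ℂ,
      (show E [⋀^Fin (k + 1)]→L[ℝ] ℂ from mextDeriv η x) = A'.restrictScalars ℝ := by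
  obtain ⟨g, hg, heq⟩ := h
  set c := extChartAt 𝓘(ℝ, E) x x with hc
  set R : (E [⋀^Fin k]→L[ℂ] ℂ) →L[ℝ] (E [⋀^Fin k]→L[ℝ] ℂ) :=
    ContinuousAlternatingMap.restrictScalarsCLM (𝕜 := ℂ) (E := E) (F := ℂ) (ι := Fin k) ℝ
    with hRdef
  have hR : HasFDerivAt (fun y ↦ (g y).restrictScalars ℝ)
      (R.comp ((fderiv ℂ g c).restrictScalars ℝ)) c :=
    R.hasFDerivAt.comp c (hg.differentiableAt.hasFDerivAt.restrictScalars ℝ)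
  have h1 : fderiv ℝ (η.inChart x) c = _ := heq.fderiv_eq.trans hR.fderiv
  refine ⟨ContinuousAlternatingMap.alternatizeUncurryFin (fderiv ℂ g c), ?_⟩
  have hd : (show E [⋀^Fin (k + 1)]→L[ℝ] ℂ from mextDeriv η x) = extDeriv (η.inChart x) c := by
    rw [mextDeriv_eq_extDerivWithin, ModelWithCorners.Boundaryless.range_eq_univ, extDerivWithin_univ]
  rw [hd]
  ext v
  simp only [extDeriv, h1, ContinuousAlternatingMap.alternatizeUncurryFin_apply,
    ContinuousAlternatingMap.coe_restrictScalars]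
  simp [hRdef]

end Germ

/-! ### Smooth functions with support in an open set times forms smooth there -/

section Support

variable {E : Type*} [NormedAddCommGroup E] [NormedSpace ℝ E]
  {H : Type*} [TopologicalSpace H] {I : ModelWithCorners ℝ E H}
  {M : Type*} [TopologicalSpace M] [ChartedSpace H M]
  {F : Type*} [NormedAddCommGroup F] [NormedSpace ℝ F] {k : ℕ}

/-- **`ρ • η` is smooth everywhere** when `ρ` is a smooth function with `tsupport ρ ⊆ U` and `η` is
smooth at the points of `U`: at the points of `U` by the Leibniz bookkeeping
(`MForm.SmoothAt.fun_smul`), and near every other point `ρ • η` vanishes (extension by zero of a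
section supported in `U`, Lee Lemma 2.26 / Warner 1.11). [cite: LeeSmoothManifolds2013, Lemma 2.26]
[cite: WarnerGTM94, 1.11] -/
theorem MForm.smoothAt_fun_smul_of_tsupport_subset {U : Set M} {η : MForm I M F k}
    (hη : ∀ y ∈ U, η.SmoothAt y) {ρ : M → ℝ} (hρ : ContMDiff I 𝓘(ℝ) ∞ ρ) (hsupp : tsupport ρ ⊆ U)
    (y : M) : (ρ • η).SmoothAt y := by
  by_cases hy : y ∈ U
  · exact (hη y hy).fun_smul (hρ y)
  · have h0 : ρ =ᶠ[𝓝 y] 0 := notMem_tsupport_iff_eventuallyEq.1 fun h ↦ hy (hsupp h)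
    refine MForm.smoothAt_of_eventuallyEq_zero (h0.mono fun z hz ↦ ?_)
    change ρ z • η z = 0
    rw [hz, Pi.zero_apply, zero_smul]

/-- Off `U ⊇ tsupport ρ`, `ρ • η` vanishes near the point (so its exterior derivative vanishes there;
Lee Lemma 2.26). [cite: LeeSmoothManifolds2013, Lemma 2.26] -/
theorem MForm.fun_smul_eventuallyEq_zero_of_tsupport_subset {U : Set M} {η : MForm I M F k}
    {ρ : M → ℝ} (hsupp : tsupport ρ ⊆ U) {y : M} (hy : y ∉ U) :
    ∀ᶠ z in 𝓝 y, (ρ • η) z = (0 : MForm I M F k) z := by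
  have h0 : ρ =ᶠ[𝓝 y] 0 := notMem_tsupport_iff_eventuallyEq.1 fun h ↦ hy (hsupp h)
  filter_upwards [h0] with z hz
  change ρ z • η z = 0
  rw [hz, Pi.zero_apply, zero_smul]

/-- The chart differential of `ρ` at a point off `U ⊇ tsupport ρ` vanishes (`ρ` is zero near the point;
Lee Lemma 2.26 / Prop. 3.6 locality of the differential). [cite: LeeSmoothManifolds2013, Lemma 2.26] -/
theorem fderivWithin_comp_extChartAt_symm_eq_zero_of_tsupport_subset {U : Set M} {ρ : M → ℝ}
    (hsupp : tsupport ρ ⊆ U) {y : M} (hy : y ∉ U) :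
    fderivWithin ℝ (ρ ∘ (extChartAt I y).symm) (range I) (extChartAt I y y) = 0 := by
  have h0 : ρ =ᶠ[𝓝 y] 0 := notMem_tsupport_iff_eventuallyEq.1 fun h ↦ hy (hsupp h)
  have hc : ContinuousAt (extChartAt I y).symm (extChartAt I y y) :=
    continuousAt_extChartAt_symm' (mem_extChartAt_source (I := I) y)
  have h0' : ∀ᶠ w in 𝓝 ((extChartAt I y).symm (extChartAt I y y)), ρ w = 0 := by
    rw [extChartAt_to_inv]; exact h0
  have h1 : (ρ ∘ (extChartAt I y).symm) =ᶠ[𝓝 (extChartAt I y y)] fun _ ↦ 0 :=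
    (hc.tendsto.eventually h0').mono fun z hz ↦ hz
  rw [(h1.filter_mono nhdsWithin_le_nhds).fderivWithin_eq h1.self_of_nhds, fderivWithin_const_apply]

end Support

/-! ### The glued form: smoothness, vertical agreement, the vertical `(1,0)`-condition -/

section Glue

variable {ET : Type*} [NormedAddCommGroup ET] [NormedSpace ℂ ET]
  {T : Type*} [TopologicalSpace T] [ChartedSpace ET T] [IsManifold 𝓘(ℝ, ET) ∞ T]
  {k : ℕ} {ι : Type*} [Fintype ι]
  {U : ι → Set T} {Ξ : ι → MForm 𝓘(ℝ, ET) T ℂ k} {χ : ι → T → ℝ}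

omit [IsManifold 𝓘(ℝ, ET) ∞ T] in
/-- **(1) The glued form `∑ a, χ a • Ξ a` is smooth**, for `Ξ a` holomorphic in charts at the points
of `U a` and smooth `χ a` with `tsupport (χ a) ⊆ U a`. [cite: WarnerGTM94, Thm. 2.20] -/
theorem isSmoothForm_sum_smul
    (hΞ : ∀ a, ∀ y ∈ U a, ∃ g : ET → ET [⋀^Fin k]→L[ℂ] ℂ, AnalyticAt ℂ g (extChartAt 𝓘(ℝ, ET) y y) ∧
      (Ξ a).inChart y =ᶠ[𝓝 (extChartAt 𝓘(ℝ, ET) y y)] fun z ↦ (g z).restrictScalars ℝ)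
    (hχ : ∀ a, ContMDiff 𝓘(ℝ, ET) 𝓘(ℝ) ∞ (χ a)) (hsupp : ∀ a, tsupport (χ a) ⊆ U a) :
    IsSmoothForm (∑ a, χ a • Ξ a) := by
  rw [isSmoothForm_iff_smoothAt]
  intro y
  exact MForm.smoothAt_finset_sum fun a _ ↦ MForm.smoothAt_fun_smul_of_tsupport_subset
    (fun z hz ↦ MForm.smoothAt_of_analyticGerm (hΞ a z hz)) (hχ a) (hsupp a) y

omit [IsManifold 𝓘(ℝ, ET) ∞ T] in
/-- **(2) On vertical tuples the glued form equals each local form**: at `y ∈ G'` with `y ∈ U a`,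
for `w` vertical, `(∑ b, χ b • Ξ b) y w = Ξ a y w` — the `Ξ b` with `y ∈ U b` agree with `Ξ a` on
`w`, the other `χ b` vanish at `y`, and `Σ χ(y) = 1`. [cite: VoisinHodgeI2002, §9.1.1] -/
theorem sum_smul_apply_eq_of_vertical (Vert : T → ET → Prop) (hsupp : ∀ a, tsupport (χ a) ⊆ U a)
    {G' : Set T} (hsum : ∀ y ∈ G', ∑ a, χ a y = 1)
    (hagree : ∀ a b, ∀ y ∈ G', y ∈ U a → y ∈ U b → ∀ w : Fin k → ET, (∀ i, Vert y (w i)) →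
      Ξ a y w = Ξ b y w)
    {y : T} (hy : y ∈ G') {a : ι} (ha : y ∈ U a) (w : Fin k → ET) (hw : ∀ i, Vert y (w i)) :
    (∑ b, χ b • Ξ b) y w = Ξ a y w := by
  classical
  have hterm : ∀ b, (χ b • Ξ b) y w = χ b y • Ξ a y w := by
    intro b
    change (χ b y • Ξ b y) w = _
    rw [ContinuousAlternatingMap.smul_apply]
    by_cases hb : y ∈ U b
    · rw [hagree b a y hy hb ha w hw]
    · have h0 : χ b y = 0 := by
        have h := notMem_tsupport_iff_eventuallyEq.1 fun h ↦ hb (hsupp b h)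
        exact h.self_of_nhds
      rw [h0, zero_smul, zero_smul]
  rw [Finset.sum_apply, ContinuousAlternatingMap.sum_apply]
  simp_rw [hterm]
  rw [← Finset.sum_smul, hsum y hy, one_smul]

/-- **(3) The vertical `(1,0)`-condition of the glued form.** At `y ∈ G'` (open, `Σ χ = 1` on `G'`),
for every `v` and every VERTICAL tuple `w`:
`d(∑ a, χ a • Ξ a) y (i v, w) = i · d(∑ a, χ a • Ξ a) y (v, w)`. Proof in the module docstring:
Leibniz per `a`, `ℂ`-linearity of `χ_a dΞ_a` and of the slots `≥ 1` of `dχ_a ∧ Ξ_a` in `v`, and the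
slot-`0` terms sum to `d(Σ χ)(v) · c_w = 0` by agreement. This is the hypothesis `hdΞ` of
`differentiableAt_complex_cintegral_wedge_pullback_family_of_vertical` (with `Vert y w := dπ_y w = 0`).
[cite: VoisinHodgeI2002, §10.2.2 (proof of Thm. 10.9)] [cite: Griffiths1968PeriodsII, §II]
[cite: WarnerGTM94, Thm. 2.20] -/
theorem mextDeriv_sum_smul_cons_I_smul
    (hΞ : ∀ a, ∀ y ∈ U a, ∃ g : ET → ET [⋀^Fin k]→L[ℂ] ℂ, AnalyticAt ℂ g (extChartAt 𝓘(ℝ, ET) y y) ∧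
      (Ξ a).inChart y =ᶠ[𝓝 (extChartAt 𝓘(ℝ, ET) y y)] fun z ↦ (g z).restrictScalars ℝ)
    (hχ : ∀ a, ContMDiff 𝓘(ℝ, ET) 𝓘(ℝ) ∞ (χ a)) (hsupp : ∀ a, tsupport (χ a) ⊆ U a)
    (Vert : T → ET → Prop) {G' : Set T} (hG' : IsOpen G') (hsum : ∀ y ∈ G', ∑ a, χ a y = 1)
    (hagree : ∀ a b, ∀ y ∈ G', y ∈ U a → y ∈ U b → ∀ w : Fin k → ET, (∀ i, Vert y (w i)) →
      Ξ a y w = Ξ b y w)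
    {y : T} (hy : y ∈ G') (v : ET) (w : Fin k → ET) (hw : ∀ i, Vert y (w i)) :
    (show ET [⋀^Fin (k + 1)]→L[ℝ] ℂ from mextDeriv (∑ a, χ a • Ξ a) y) (Fin.cons (I • v) w) =
      I * (show ET [⋀^Fin (k + 1)]→L[ℝ] ℂ from mextDeriv (∑ a, χ a • Ξ a) y) (Fin.cons v w) := by
  classical
  -- `Fin.cons = Matrix.vecCons` (the spelling of `curryLeft_apply_apply`, `vecCons_smul`)
  change (show ET [⋀^Fin (k + 1)]→L[ℝ] ℂ from mextDeriv (∑ a, χ a • Ξ a) y) (Matrix.vecCons (I • v) w) =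
    I * (show ET [⋀^Fin (k + 1)]→L[ℝ] ℂ from mextDeriv (∑ a, χ a • Ξ a) y) (Matrix.vecCons v w)
  -- notation: the chart at `y`, the chart differentials `θ a` of the `χ a`
  set e := extChartAt 𝓘(ℝ, ET) y with he
  set θ : ι → (ET →L[ℝ] ℝ) := fun a ↦ fderivWithin ℝ (χ a ∘ e.symm) (range 𝓘(ℝ, ET)) (e y) with hθ
  have hUd : UniqueDiffWithinAt ℝ (range 𝓘(ℝ, ET)) (e y) :=
    (𝓘(ℝ, ET)).uniqueDiffOn _ (extChartAt_target_subset_range y (mem_extChartAt_target y))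
  -- an index `a₀` with `y ∈ U a₀` (from `Σ χ(y) = 1`), and the common vertical value `c_w`
  obtain ⟨a₀, -, ha₀⟩ : ∃ a ∈ Finset.univ, χ a y ≠ 0 :=
    Finset.exists_ne_zero_of_sum_ne_zero (by rw [hsum y hy]; exact one_ne_zero)
  have hya₀ : y ∈ U a₀ := hsupp a₀ (subset_tsupport _ (Function.mem_support.2 ha₀))
  set cw : ℂ := Ξ a₀ y w with hcw
  -- (i) `Σ_a θ a = 0`: `Σ_a χ a = 1` near `y`
  have hθsum : ∑ a, θ a = 0 := by
    have hdiff : ∀ a ∈ (Finset.univ : Finset ι),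
        DifferentiableWithinAt ℝ (χ a ∘ e.symm) (range 𝓘(ℝ, ET)) (e y) := fun a _ ↦
      differentiableWithinAt_comp_extChartAt_symm ((hχ a).mdifferentiableAt (by simp) (x := y))
    have h1 : ∑ a, θ a = fderivWithin ℝ (fun z ↦ ∑ a, (χ a ∘ e.symm) z) (range 𝓘(ℝ, ET)) (e y) := by
      rw [fderivWithin_fun_sum hUd hdiff]
    have hc : ContinuousAt e.symm (e y) := continuousAt_extChartAt_symm' (mem_extChartAt_source (I := 𝓘(ℝ, ET)) y)
    have hG'y : ∀ᶠ x in 𝓝 (e.symm (e y)), x ∈ G' := by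
      rw [he, extChartAt_to_inv]; exact hG'.mem_nhds hy
    have h2 : (fun z ↦ ∑ a, (χ a ∘ e.symm) z) =ᶠ[𝓝 (e y)] fun _ ↦ (1 : ℝ) :=
      (hc.tendsto.eventually hG'y).mono fun z hz ↦ by simpa only [Function.comp_apply] using hsum _ hz
    rw [h1, (h2.filter_mono nhdsWithin_le_nhds).fderivWithin_eq h2.self_of_nhds, fderivWithin_const_apply]
  -- (ii) the Leibniz formula for every `a`, at both tuples
  have hleib : ∀ a (u : ET), (show ET [⋀^Fin (k + 1)]→L[ℝ] ℂ from mextDeriv (χ a • Ξ a) y)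
      (Matrix.vecCons u w) = χ a y • (show ET [⋀^Fin (k + 1)]→L[ℝ] ℂ from mextDeriv (Ξ a) y)
        (Matrix.vecCons u w) + wedgeOne (θ a) (show ET [⋀^Fin k]→L[ℝ] ℂ from Ξ a y) (Matrix.vecCons u w) := by
    intro a u
    by_cases ha : y ∈ U a
    · exact mextDeriv_fun_smul_apply ((hχ a).mdifferentiableAt (by simp))
        (MForm.smoothAt_of_analyticGerm (hΞ a y ha)) _
    · have h0 := mextDeriv_congr_of_eventuallyEq
        (MForm.fun_smul_eventuallyEq_zero_of_tsupport_subset (η := Ξ a) (hsupp a) ha)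
      have hL : (show ET [⋀^Fin (k + 1)]→L[ℝ] ℂ from mextDeriv (χ a • Ξ a) y) = 0 := by
        rw [h0, mextDeriv_zero]
        rfl
      have hχ0 : χ a y = 0 :=
        (notMem_tsupport_iff_eventuallyEq.1 fun h ↦ ha (hsupp a h)).self_of_nhds
      have hθ0 : θ a = 0 := fderivWithin_comp_extChartAt_symm_eq_zero_of_tsupport_subset (hsupp a) ha
      rw [hL, hχ0, hθ0, wedgeOne_zero_left, zero_smul, zero_add, ContinuousAlternatingMap.coe_zero,
        Pi.zero_apply]
  -- (iii) the defect of each summand is `(θ a (i v) - i θ a v) · c_w`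
  have hdefect : ∀ a, (show ET [⋀^Fin (k + 1)]→L[ℝ] ℂ from mextDeriv (χ a • Ξ a) y)
      (Matrix.vecCons (I • v) w) - I * (show ET [⋀^Fin (k + 1)]→L[ℝ] ℂ from mextDeriv (χ a • Ξ a) y)
        (Matrix.vecCons v w) = ((θ a (I • v) : ℂ) - I * θ a v) * cw := by
    intro a
    rw [hleib a (I • v), hleib a v, Complex.real_smul, Complex.real_smul]
    by_cases ha : y ∈ U a
    · obtain ⟨A, hA⟩ := MForm.exists_apply_eq_restrictScalars_of_analyticGerm (hΞ a y ha)
      obtain ⟨A', hA'⟩ := MForm.exists_mextDeriv_eq_restrictScalars_of_analyticGerm (hΞ a y ha)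
      have hAw : A w = cw := by
        have h := hagree a a₀ y hy ha hya₀ w hw
        rw [hA] at h
        exact h
      -- `dΞ_a y` is `ℂ`-linear in slot `0`
      have e1 : (show ET [⋀^Fin (k + 1)]→L[ℝ] ℂ from mextDeriv (Ξ a) y) (Matrix.vecCons (I • v) w) =
          I * (show ET [⋀^Fin (k + 1)]→L[ℝ] ℂ from mextDeriv (Ξ a) y) (Matrix.vecCons v w) := by
        rw [hA']
        change A' (Matrix.vecCons (I • v) w) = I * A' (Matrix.vecCons v w)
        rw [A'.vecCons_smul, smul_eq_mul]
      -- the slot-`0` defect of `dχ_a ∧ Ξ_a y`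
      have e2 : wedgeOne (θ a) (show ET [⋀^Fin k]→L[ℝ] ℂ from Ξ a y) (Matrix.vecCons (I • v) w) -
          I * wedgeOne (θ a) (show ET [⋀^Fin k]→L[ℝ] ℂ from Ξ a y) (Matrix.vecCons v w) =
            ((θ a (I • v) : ℂ) - I * θ a v) * cw := by
        rw [show (show ET [⋀^Fin k]→L[ℝ] ℂ from Ξ a y) = A.restrictScalars ℝ from hA, ← hAw]
        exact wedgeOne_restrictScalars_vecCons_I_smul_sub (θ a) A v w
      linear_combination (χ a y : ℂ) * e1 + e2
    · have hθ0 : θ a = 0 := fderivWithin_comp_extChartAt_symm_eq_zero_of_tsupport_subset (hsupp a) ha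
      have hχ0 : χ a y = 0 :=
        (notMem_tsupport_iff_eventuallyEq.1 fun h ↦ ha (hsupp a h)).self_of_nhds
      simp [hθ0, hχ0, wedgeOne_zero_left]
  -- (iv) sum over `a`
  have hsm : ∀ a ∈ (Finset.univ : Finset ι), (χ a • Ξ a).SmoothAt y := fun a _ ↦
    MForm.smoothAt_fun_smul_of_tsupport_subset
      (fun z hz ↦ MForm.smoothAt_of_analyticGerm (hΞ a z hz)) (hχ a) (hsupp a) y
  have hsumd : (show ET [⋀^Fin (k + 1)]→L[ℝ] ℂ from mextDeriv (∑ a, χ a • Ξ a) y) =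
      ∑ a, (show ET [⋀^Fin (k + 1)]→L[ℝ] ℂ from mextDeriv (χ a • Ξ a) y) :=
    mextDeriv_finset_sum_apply hsm
  rw [← sub_eq_zero, hsumd, ContinuousAlternatingMap.sum_apply, ContinuousAlternatingMap.sum_apply,
    Finset.mul_sum, ← Finset.sum_sub_distrib, Finset.sum_congr rfl fun a _ ↦ hdefect a,
    ← Finset.sum_mul]
  have hre : ∑ a, ((θ a (I • v) : ℂ) - I * θ a v) = ((∑ a, θ a) (I • v) : ℂ) - I * (∑ a, θ a) v := by
    rw [Finset.sum_sub_distrib, FunLike.coe_sum, Finset.sum_apply, Finset.sum_apply, Complex.ofReal_sum,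
      Complex.ofReal_sum, Finset.mul_sum]
  rw [hre, hθsum]
  simp

end Glue

/-! ### (4) Smooth partitions of unity subordinate to a finite open cover of a closed set -/

section Partition

variable {ET : Type*} [NormedAddCommGroup ET] [NormedSpace ℂ ET] [FiniteDimensional ℂ ET]
  {T : Type*} [TopologicalSpace T] [ChartedSpace ET T] [IsManifold 𝓘(ℝ, ET) ∞ T]
  [T2Space T] [SigmaCompactSpace T] {ι : Type*} [Fintype ι]

/-- **A smooth partition of unity subordinate to a finite open cover of a closed set** (Mathlib's
`SmoothPartitionOfUnity.exists_isSubordinate`, unbundled): smooth `χ a ≥ 0` with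
`tsupport (χ a) ⊆ U a` and `Σ_a χ a = 1` on `s`. (Take `s ⊇ G'` open to feed
`mextDeriv_sum_smul_cons_I_smul`.) [cite: LeeSmoothManifolds2013, Thm. 2.23] [cite: WarnerGTM94, 1.11] -/
theorem exists_smooth_partition_subordinate {s : Set T} (hs : IsClosed s) (U : ι → Set T)
    (hU : ∀ a, IsOpen (U a)) (hsU : s ⊆ ⋃ a, U a) :
    ∃ χ : ι → T → ℝ, (∀ a, ContMDiff 𝓘(ℝ, ET) 𝓘(ℝ) ∞ (χ a)) ∧ (∀ a, tsupport (χ a) ⊆ U a) ∧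
      (∀ a y, 0 ≤ χ a y) ∧ ∀ y ∈ s, ∑ a, χ a y = 1 := by
  haveI : FiniteDimensional ℝ ET := FiniteDimensional.complexToReal ET
  obtain ⟨f, hf⟩ := SmoothPartitionOfUnity.exists_isSubordinate 𝓘(ℝ, ET) hs U hU hsU
  refine ⟨fun a ↦ f a, fun a ↦ (f a).contMDiff, hf, fun a y ↦ f.nonneg a y, fun y hy ↦ ?_⟩
  have h := f.sum_eq_one hy
  rwa [finsum_eq_sum_of_fintype] at h

end Partition

end Literature.Geometry.Kaehler

end
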